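import Mathlib
import HarnessLib
import Summits.AtomisticToContinuum.Crystallization.Theorems.FrustratedLawDichotomyTwoShellRigidityLsFitPrmFcc

/-!
# Two-shell rigidity, slot 3 · `SphericalLsFit` certificate data (fcc, shard 14): cells 77 … 99 (whole) and their replay

Base64 certificate cells 77 ≤ i < 100 of the 100 cells of the braced ω-sub-leaf B-run of record for
`Rig.checkAllF fccModel prmFcc fccCellsF` — 23 cells, 24 instructions, 846 bytes, one string per cell (all pruned or vacuous
cells: no `fit` leaf) — their decoding `fccCellsF14`, and the replay `fcc_runCellF_14 : fccCellsF14.all (runCellF fccModel prmFcc) = true`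
(`native_decide`; parameters `prmFcc` from `…LsFitPrmFcc`).
(`β = 7/200`, `θ = 1/100`, probes `ptab26`; decomp-a2c census-1 g22, kit j345739, generator `rig_fitgen.py`: LP contraction +
Farkas pruning with the 12 brace rows live, ω-splits (`split` on the leaf-frame functionals `fitObjW`), per ω-sub-leaf a re-centred integer
quaternion and 954 `fit` certificates, scale `2^60`; byte format `…TwoShellRigidityLsFitReplayDecode.decodeCellF`).  Sharding per critic
row 703 (b): modules ≤ 190 kB, lines ≤ 16 kB; a cell larger than one line is stored as consecutive ≤ 15 kB pieces re-joined by `String.join`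
before decoding.  Cell order: chart `x ≥ 0` then `x ≤ 0`, ascending in the free parameter.
-/

namespace Summit.AtomisticToContinuum.Crystallization.Theorems

namespace Rig

/-- `SphericalLsFit` certificate cells (fcc) 77 … 99, one string per cell. -/
def fccFitData14 : Array String := #[
  "ANyeiq6PhdfHAoquj4XXx8LrAwAEAAAMBQORMwarNw3bGw+kAxLDNQAEAgEMBQPIWAbLXw3vDw/ZBRL+XAAIAAAMAwPWDw+YAhLfIwAIAQEMBAOLuwIG+7sCDY+hARKAwAIBBQPqAQaAAg0uDxAS+AE",
  "AIquj4XXx8LrA7i9lNyeiq6PBQEDA2oPFhKAAg",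
  "ALi9lNyeiq6PBebMmbPmzJmzBgECDxwSgAI",
  "AObMmbPmzJmzBpTcnoquj4XXBwEBEoAC",
  "AJTcnoquj4XXB8Lro+H10fD6CAEBEoAC",
  "AMLro+H10fD6CPD6qLi9lNyeCgEBEoAC",
  "APD6qLi9lNyeCp6Kro+F18fCCwEBEoAC",
  "AJ6Kro+F18fCC8yZs+bMmbPmDAEBEoAC",
  "AMyZs+bMmbPmDPqouL2U3J6KDgEBEoAC",
  "APqouL2U3J6KDqi4vZTcnoquDwEBEoAC",
  "AKi4vZTcnoquD9bHwuuj4fXREAEBEoAC",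
  "ANbHwuuj4fXREITXx8Lro+H1EQEBEoAC",
  "AITXx8Lro+H1EbLmzJmz5syZEwEBEoAC",
  "ALLmzJmz5syZE+D10fD6qLi9FAEBEoAC",
  "AOD10fD6qLi9FI6F18fC66PhFQEBEoAC",
  "AI6F18fC66PhFbyU3J6Kro+FFwEBEoAC",
  "ALyU3J6Kro+FF+qj4fXR8PqoGAEBEoAC",
  "AOqj4fXR8PqoGJiz5syZs+bMGQEBEoAC",
  "AJiz5syZs+bMGcbC66Ph9dHwGgEBEoAC",
  "AMbC66Ph9dHwGvTR8PqouL2UHAEBEoAC",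
  "APTR8PqouL2UHKLh9dHw+qi4HQ",
  "AKLh9dHw+qi4HdDw+qi4vZTcHg",
  "ANDw+qi4vZTcHoCAgICAgICAIA"]

/-- The decoded cells 77 … 99. -/
def fccCellsF14 : List CellF := fccFitData14.toList.map decodeCellF

/-- Cells 77 … 99 of the fcc fit run pass `runCellF fccModel prmFcc`. -/
theorem fcc_runCellF_14 : fccCellsF14.all (runCellF fccModel prmFcc) = true := by
  native_decide

end Rig

end Summit.AtomisticToContinuum.Crystallization.Theorems
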